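import Literature.Probability.Percolation.RSWProofs
import HarnessLib

/-!
# Open-path surgery at one vertex: the combinatorics of the `k = 2` one-sided Russo cone

Helper file for the stub `stub_cone2` of the line `finite-size-envelope` (crux `CriticalPathRSW`,
route `CardySelfRefinement`). Pure graph combinatorics for bond configurations `ω ⊆ E(G)` on a
simple graph `G` (applied to `ℤ²`), around a vertex `m` whose neighbours are among four vertices
`a, b, n, n'` — for the self-refinement model `M_2`, `m` is the midpoint of a tuple `a — m — b` and
`{m, n}`, `{m, n'}` are the two interior edges at `m`:

* walk toolkit (with the tree's `openConnIn_mono`, `openCrossing_comm` of `RSW.lean` /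
  `RSWProofs.lean`): last-exit decomposition at `m` (`exists_adj_mem_openConnIn_sdiff`), avoiding or
  passing through `m` (`openConnIn_sdiff_singleton_or`), transfer of connections inside `S` between
  configurations agreeing on the edges of `S` (`openConnIn_of_forall_edge`), and the trichotomy for a
  connection using one extra edge `{a, m}` (`openConnIn_insert_edge`);
* the **class lemma** `exists_cls_of_neg`: if opening `{a, m}` alone and opening `{m, b}` alone
  each create a crossing of `S` from `P` to `Q` but `ω` has none (the negative selector class
  `{01, 10, 11}`), then, up to exchanging `P, Q` and `n, n'`, the configuration is in the CLASS
  "`m, n ∈ S`, `{m, n}` open, no crossing, `n ⇝ Q`, `P ⇝ a`, `P ⇝ b`, all three avoiding `m`";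
* the class is stable under closing any other edge at `m` (`cls_sdiff_edge`), and in the class,
  once a tuple edge is open and `{m, n'}` is closed, the interior edge `{m, n}` is pivotal for the
  crossing (`pivotal_of_cls`).

This is §E2 of the crux triage (TRIAGE-r1-2) / the card `signed-cone-envelope`, written for a
general graph. No definitions: the class is the displayed conjunction.
-/

namespace Summit.CriticalPhenomena.CardyFormulaZ2.Cruxes.CriticalPathRSW.FiniteSizeEnvelope.Cone2

open Literature.Probability.Percolation SimpleGraph

variable {V : Type*} {G : SimpleGraph V}

/-! ### Walk toolkit -/

/-- **Transfer.** If `ω'` contains every edge of `ω` with both endpoints in `S`, then every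
connection of `ω` inside `S` is a connection of `ω'`. [folklore] -/
theorem openConnIn_of_forall_edge {ω ω' : BondConfig V} (hω : ω ⊆ G.edgeSet) {S : Set V} {x y : V}
    (h : ω ∈ openConnIn S x y) (hωω' : ∀ u v, s(u, v) ∈ ω → u ∈ S → v ∈ S → s(u, v) ∈ ω') :
    ω' ∈ openConnIn S x y := by
  obtain ⟨p, hpS, hpω⟩ := exists_walk_of_mem_openConnIn hω h
  refine mem_openConnIn_of_walk p hpS fun e => ?_
  refine Sym2.inductionOn e fun u v he => ?_
  exact hωω' u v (hpω _ he) (hpS u (p.fst_mem_support_of_mem_edges he))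
    (hpS v (p.snd_mem_support_of_mem_edges he))

/-- A connection from `x` to `y` inside `S` either avoids the vertex `m` or splits at `m`. [folklore] -/
theorem openConnIn_sdiff_singleton_or {ω : BondConfig V} (hω : ω ⊆ G.edgeSet) {S : Set V} {x y : V}
    (m : V) (h : ω ∈ openConnIn S x y) :
    ω ∈ openConnIn (S \ {m}) x y ∨ (ω ∈ openConnIn S x m ∧ ω ∈ openConnIn S m y) := by
  classical
  obtain ⟨p, hpS, hpω⟩ := exists_walk_of_mem_openConnIn hω h
  by_cases hm : m ∈ p.support
  · right
    exact ⟨mem_openConnIn_of_walk (p.takeUntil m hm)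
        (fun z hz => hpS z (p.support_takeUntil_subset_support hm hz))
        (fun e he => hpω e (p.edges_takeUntil_subset_edges hm he)),
      mem_openConnIn_of_walk (p.dropUntil m hm)
        (fun z hz => hpS z (p.support_dropUntil_subset_support hm hz))
        (fun e he => hpω e (p.edges_dropUntil_subset_edges hm he))⟩
  · left
    refine mem_openConnIn_of_walk p (fun z hz => ⟨hpS z hz, fun hzm => hm ?_⟩) hpω
    rw [Set.mem_singleton_iff] at hzm
    exact hzm ▸ hz

/-- A walk from `m` to `y ≠ m` visiting `m` once starts with an edge `{m, m'}` followed by a walk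
avoiding `m`. [folklore] -/
theorem exists_cons_of_count_support [DecidableEq V] {m y : V} (r : G.Walk m y) (hmy : m ≠ y)
    (hc : r.support.count m = 1) :
    ∃ (m' : V) (h : G.Adj m m') (r' : G.Walk m' y), r = Walk.cons h r' ∧ m ∉ r'.support := by
  cases r with
  | nil => exact absurd rfl hmy
  | cons h r' =>
    refine ⟨_, h, r', rfl, fun hm => ?_⟩
    rw [Walk.support_cons, List.count_cons_self] at hc
    have h0 : r'.support.count m = 0 := by omega
    exact (List.count_eq_zero.1 h0) hm

/-- **Last-exit decomposition.** A connection from `m` to `y ≠ m` inside `S` leaves `m` for the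
last time through an open edge `{m, m'}` of `G` and then joins `m'` to `y` inside `S \ {m}`.
[folklore] -/
theorem exists_adj_mem_openConnIn_sdiff {ω : BondConfig V} (hω : ω ⊆ G.edgeSet) {S : Set V}
    {m y : V} (h : ω ∈ openConnIn S m y) (hmy : m ≠ y) :
    ∃ m', G.Adj m m' ∧ s(m, m') ∈ ω ∧ ω ∈ openConnIn (S \ {m}) m' y := by
  classical
  obtain ⟨p, hpS, hpω⟩ := exists_walk_of_mem_openConnIn hω h
  -- cut the reversed walk at its first visit to `m`, and reverse back
  have hm : m ∈ p.reverse.support := Walk.end_mem_support _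
  set q : G.Walk y m := p.reverse.takeUntil m hm with hq
  have hqc : q.support.count m = 1 := p.reverse.count_support_takeUntil_eq_one hm
  have hqS : ∀ z ∈ q.support, z ∈ S := fun z hz => hpS z (by
    have := p.reverse.support_takeUntil_subset_support hm hz
    rwa [Walk.support_reverse, List.mem_reverse] at this)
  have hqω : ∀ e ∈ q.edges, e ∈ ω := fun e he => hpω e (by
    have := p.reverse.edges_takeUntil_subset_edges hm he
    rwa [Walk.edges_reverse, List.mem_reverse] at this)
  have hrc : q.reverse.support.count m = 1 := by
    rw [Walk.support_reverse, List.count_reverse]; exact hqc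
  obtain ⟨m', hadj, r', hr, hm'⟩ := exists_cons_of_count_support q.reverse hmy hrc
  have hrS : ∀ z ∈ q.reverse.support, z ∈ S := fun z hz => hqS z (by
    rwa [Walk.support_reverse, List.mem_reverse] at hz)
  have hrω : ∀ e ∈ q.reverse.edges, e ∈ ω := fun e he => hqω e (by
    rwa [Walk.edges_reverse, List.mem_reverse] at he)
  rw [hr] at hrS hrω
  refine ⟨m', hadj, hrω _ (by simp [Walk.edges_cons]), mem_openConnIn_of_walk r' (fun z hz => ?_)
    (fun e he => hrω e (by simp [Walk.edges_cons, he]))⟩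
  refine ⟨hrS z (by simp [Walk.support_cons, hz]), fun hzm => hm' ?_⟩
  rw [Set.mem_singleton_iff] at hzm
  exact hzm ▸ hz

/-- **One extra edge.** If `x` is joined to `y` inside `S` using the open edges of `ω` and possibly
the edge `{a, m}` of `G`, then either `ω` already joins `x` to `y`, or it joins `x` to `a` and `m`
to `y`, or `x` to `m` and `a` to `y` (induction along the walk). [folklore] -/
theorem openConnIn_insert_edge {ω : BondConfig V} (hω : ω ⊆ G.edgeSet) {a m : V} (ham : G.Adj a m)
    {S : Set V} {x y : V} (h : insert s(a, m) ω ∈ openConnIn S x y) :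
    ω ∈ openConnIn S x y ∨ (ω ∈ openConnIn S x a ∧ ω ∈ openConnIn S m y) ∨
      (ω ∈ openConnIn S x m ∧ ω ∈ openConnIn S a y) := by
  have hω' : insert s(a, m) ω ⊆ G.edgeSet := Set.insert_subset ham hω
  obtain ⟨p, hpS, hpω⟩ := exists_walk_of_mem_openConnIn hω' h
  clear h
  induction p with
  | nil =>
    exact Or.inl (openConnIn_refl (hpS _ (Walk.start_mem_support _)))
  | cons hadj p ih =>
    rename_i u v w
    have hu : u ∈ S := hpS u (by simp)
    have hv : v ∈ S := hpS v (by simp)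
    have ih' := ih (fun z hz => hpS z (by simp [hz])) (fun e he => hpω e (by simp [he]))
    have huv : s(u, v) ∈ insert s(a, m) ω := hpω _ (by simp)
    rcases huv with huv | huv
    · -- the step is the extra edge
      rcases Sym2.eq_iff.1 huv with ⟨rfl, rfl⟩ | ⟨rfl, rfl⟩
      · rcases ih' with h1 | ⟨-, h2⟩ | ⟨-, h2⟩
        · exact Or.inr (Or.inl ⟨openConnIn_refl hu, h1⟩)
        · exact Or.inr (Or.inl ⟨openConnIn_refl hu, h2⟩)
        · exact Or.inl h2
      · rcases ih' with h1 | ⟨-, h2⟩ | ⟨-, h2⟩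
        · exact Or.inr (Or.inr ⟨openConnIn_refl hu, h1⟩)
        · exact Or.inl h2
        · exact Or.inr (Or.inr ⟨openConnIn_refl hu, h2⟩)
    · have step : ω ∈ openConnIn S u v := openConnIn_of_adj hu hv huv hadj.ne
      rcases ih' with h1 | ⟨h1, h2⟩ | ⟨h1, h2⟩
      · exact Or.inl (PlanarDuality.openConnIn_trans step h1)
      · exact Or.inr (Or.inl ⟨PlanarDuality.openConnIn_trans step h1, h2⟩)
      · exact Or.inr (Or.inr ⟨PlanarDuality.openConnIn_trans step h1, h2⟩)

/-- Transfer of an open crossing to a configuration containing the relevant edges. [folklore] -/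
theorem openCrossing_of_forall_edge {ω ω' : BondConfig V} (hω : ω ⊆ G.edgeSet) {S A B : Set V}
    (h : ω ∈ openCrossing S A B) (hωω' : ∀ u v, s(u, v) ∈ ω → u ∈ S → v ∈ S → s(u, v) ∈ ω') :
    ω' ∈ openCrossing S A B := by
  obtain ⟨x, hx, y, hy, hxy⟩ := h
  exact ⟨x, hx, y, hy, openConnIn_of_forall_edge hω hxy hωω'⟩

/-- Closing an edge at `m` does not affect crossings inside `S \ {m}`. [folklore] -/
theorem openCrossing_sdiff_edge_of_mem {ω : BondConfig V} (hω : ω ⊆ G.edgeSet) {S A B : Set V}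
    {m : V} {e : Sym2 V} (hme : m ∈ e) (h : ω ∈ openCrossing (S \ {m}) A B) :
    ω \ {e} ∈ openCrossing (S \ {m}) A B := by
  refine openCrossing_of_forall_edge hω h fun u v huv hu hv => ⟨huv, fun h' => ?_⟩
  rw [Set.mem_singleton_iff] at h'
  rw [← h'] at hme
  rcases Sym2.mem_iff.1 hme with rfl | rfl
  · exact hu.2 rfl
  · exact hv.2 rfl

/-! ### The negative selector class -/

/-- **Case two of the class lemma.** No crossing, `P ⇝ a`, `P ⇝ b`, `m ⇝ Q` but not `P ⇝ m`
(inside `S`, for `ω` with both tuple edges `{a, m}`, `{m, b}` closed and the neighbours of `m` among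
`a, b, n₁, n₂`): then for `n = n₁` or `n = n₂` the configuration is in the class
"`m, n ∈ S`, `{m, n}` open, no crossing, `n ⇝ Q`, `P ⇝ a`, `P ⇝ b` avoiding `m`". [folklore] -/
theorem exists_cls_of_caseTwo {ω : BondConfig V} (hω : ω ⊆ G.edgeSet) {S P Q : Set V}
    {a m b n₁ n₂ : V} (hnb : ∀ m', G.Adj m m' → m' = a ∨ m' = b ∨ m' = n₁ ∨ m' = n₂)
    (hQ : m ∈ Q → a ∈ S → a ∈ Q) (h1 : s(a, m) ∉ ω) (h2 : s(m, b) ∉ ω)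
    (hN0 : ω ∉ openCrossing S P Q) (hPa : ∃ x ∈ P, ω ∈ openConnIn S x a)
    (hPb : ∃ x ∈ P, ω ∈ openConnIn S x b) (hmQ : ∃ y ∈ Q, ω ∈ openConnIn S m y)
    (hPm : ¬ ∃ x ∈ P, ω ∈ openConnIn S x m) :
    ∃ n : V, (n = n₁ ∨ n = n₂) ∧ (m ∈ S ∧ n ∈ S ∧ s(m, n) ∈ ω ∧ ω ∉ openCrossing S P Q ∧
      ω ∈ openCrossing (S \ {m}) {n} Q ∧ ω ∈ openCrossing (S \ {m}) P {a} ∧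
      ω ∈ openCrossing (S \ {m}) P {b}) := by
  obtain ⟨y, hy, hmy⟩ := hmQ
  obtain ⟨xa, hxa, hxaa⟩ := hPa
  obtain ⟨xb, hxb, hxbb⟩ := hPb
  have haS : a ∈ S := hxaa.2.1
  have hmS : m ∈ S := hmy.1
  have hmQ' : m ∉ Q := fun hm => hN0 ⟨xa, hxa, a, hQ hm haS, hxaa⟩
  have hne : m ≠ y := fun h => hmQ' (h ▸ hy)
  obtain ⟨m', hadj, hmm', hconn⟩ := exists_adj_mem_openConnIn_sdiff hω hmy hne
  have hm'S : m' ∈ S \ {m} := hconn.1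
  have hn : m' = n₁ ∨ m' = n₂ := by
    rcases hnb m' hadj with h | h | h
    · subst h
      rw [Sym2.eq_swap] at hmm'
      exact absurd hmm' h1
    · subst h
      exact absurd hmm' h2
    · exact h
  -- the connections from `P` to `a`, `b` avoid `m`
  have hPa' : ω ∈ openConnIn (S \ {m}) xa a := by
    rcases openConnIn_sdiff_singleton_or hω m hxaa with h | ⟨h, -⟩
    · exact h
    · exact absurd ⟨xa, hxa, h⟩ hPm
  have hPb' : ω ∈ openConnIn (S \ {m}) xb b := by
    rcases openConnIn_sdiff_singleton_or hω m hxbb with h | ⟨h, -⟩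
    · exact h
    · exact absurd ⟨xb, hxb, h⟩ hPm
  exact ⟨m', hn, hmS, hm'S.1, hmm', hN0, ⟨m', rfl, y, hy, hconn⟩, ⟨xa, hxa, a, rfl, hPa'⟩,
    ⟨xb, hxb, b, rfl, hPb'⟩⟩

/-- **The class lemma** (negative selector class ⇒ an interior edge at the midpoint does connecting
work). Let the neighbours of `m` in `G` be among `a, b, n₁, n₂`, both tuple edges `{a, m}`,
`{m, b}` closed in `ω`, and suppose that opening `{a, m}` alone, and opening `{m, b}` alone, each
produce an open crossing of `S` from `P` to `Q` while `ω` has none. Then, up to exchanging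
`(P, Q)` and `(n₁, n₂)`: `m, n ∈ S`, `{m, n}` is open, and inside `S \ {m}` the configuration
joins `n` to `Q`, `P` to `a` and `P` to `b`. (The hypotheses `hP`, `hQ` exclude the degenerate
position of a tuple lying inside a side of the box.) [folklore] -/
theorem exists_cls_of_neg {ω : BondConfig V} (hω : ω ⊆ G.edgeSet) {S P Q : Set V}
    {a m b n₁ n₂ : V} (ham : G.Adj a m) (hmb : G.Adj m b)
    (hnb : ∀ m', G.Adj m m' → m' = a ∨ m' = b ∨ m' = n₁ ∨ m' = n₂)
    (hP : m ∈ P → a ∈ S → a ∈ P) (hQ : m ∈ Q → a ∈ S → a ∈ Q)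
    (h1 : s(a, m) ∉ ω) (h2 : s(m, b) ∉ ω)
    (hN1 : insert s(a, m) ω ∈ openCrossing S P Q) (hN2 : insert s(m, b) ω ∈ openCrossing S P Q)
    (hN0 : ω ∉ openCrossing S P Q) :
    ∃ (P' Q' : Set V) (n : V), ((P' = P ∧ Q' = Q) ∨ (P' = Q ∧ Q' = P)) ∧ (n = n₁ ∨ n = n₂) ∧
      (m ∈ S ∧ n ∈ S ∧ s(m, n) ∈ ω ∧ ω ∉ openCrossing S P' Q' ∧
        ω ∈ openCrossing (S \ {m}) {n} Q' ∧ ω ∈ openCrossing (S \ {m}) P' {a} ∧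
        ω ∈ openCrossing (S \ {m}) P' {b}) := by
  obtain ⟨x, hx, y, hy, hxy⟩ := hN1
  obtain ⟨x', hx', y', hy', hxy'⟩ := hN2
  have hN0' : ω ∉ openCrossing S Q P := by rwa [openCrossing_comm] at hN0
  rcases openConnIn_insert_edge hω ham hxy with h0 | ⟨hxa, hmy⟩ | ⟨hxm, hay⟩
  · exact absurd ⟨x, hx, y, hy, h0⟩ hN0
  · -- `P ⇝ a`, `m ⇝ Q`: no `P ⇝ m`
    have hPm : ¬ ∃ x'' ∈ P, ω ∈ openConnIn S x'' m := fun ⟨x'', hx'', h''⟩ =>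
      hN0 ⟨x'', hx'', y, hy, PlanarDuality.openConnIn_trans h'' hmy⟩
    rcases openConnIn_insert_edge hω hmb hxy' with h0 | ⟨hxm', _⟩ | ⟨hxb', _⟩
    · exact absurd ⟨x', hx', y', hy', h0⟩ hN0
    · exact absurd ⟨x', hx', hxm'⟩ hPm
    · obtain ⟨n, hn, hcls⟩ := exists_cls_of_caseTwo hω hnb hQ h1 h2 hN0 ⟨x, hx, hxa⟩
        ⟨x', hx', hxb'⟩ ⟨y, hy, hmy⟩ hPm
      exact ⟨P, Q, n, Or.inl ⟨rfl, rfl⟩, hn, hcls⟩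
  · -- `P ⇝ m`, `a ⇝ Q`: the mirror case, no `m ⇝ Q`
    have hmQ : ¬ ∃ y'' ∈ Q, ω ∈ openConnIn S y'' m := fun ⟨y'', hy'', h''⟩ =>
      hN0 ⟨x, hx, y'', hy'', PlanarDuality.openConnIn_trans hxm (by rwa [openConnIn_comm])⟩
    rcases openConnIn_insert_edge hω hmb hxy' with h0 | ⟨_, hby'⟩ | ⟨_, hmy'⟩
    · exact absurd ⟨x', hx', y', hy', h0⟩ hN0
    · obtain ⟨n, hn, hcls⟩ := exists_cls_of_caseTwo (P := Q) (Q := P) hω hnb hP h1 h2 hN0'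
        ⟨y, hy, by rwa [openConnIn_comm]⟩ ⟨y', hy', by rwa [openConnIn_comm]⟩
        ⟨x, hx, by rwa [openConnIn_comm]⟩ hmQ
      exact ⟨Q, P, n, Or.inr ⟨rfl, rfl⟩, hn, hcls⟩
    · exact absurd ⟨y', hy', by rwa [openConnIn_comm]⟩ hmQ

/-- **The class is stable under closing any other edge at `m`.** [folklore] -/
theorem cls_sdiff_edge {ω : BondConfig V} (hω : ω ⊆ G.edgeSet) {S P Q : Set V} {a b m n : V}
    {e : Sym2 V} (hme : m ∈ e) (hne : e ≠ s(m, n))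
    (h : m ∈ S ∧ n ∈ S ∧ s(m, n) ∈ ω ∧ ω ∉ openCrossing S P Q ∧
      ω ∈ openCrossing (S \ {m}) {n} Q ∧ ω ∈ openCrossing (S \ {m}) P {a} ∧
      ω ∈ openCrossing (S \ {m}) P {b}) :
    m ∈ S ∧ n ∈ S ∧ s(m, n) ∈ ω \ {e} ∧ ω \ {e} ∉ openCrossing S P Q ∧
      ω \ {e} ∈ openCrossing (S \ {m}) {n} Q ∧ ω \ {e} ∈ openCrossing (S \ {m}) P {a} ∧
      ω \ {e} ∈ openCrossing (S \ {m}) P {b} := by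
  obtain ⟨hmS, hnS, hmn, hX, hnQ, hPa, hPb⟩ := h
  refine ⟨hmS, hnS, ⟨hmn, fun h' => hne ?_⟩, fun hX' => hX ?_,
    openCrossing_sdiff_edge_of_mem hω hme hnQ, openCrossing_sdiff_edge_of_mem hω hme hPa,
    openCrossing_sdiff_edge_of_mem hω hme hPb⟩
  · rw [Set.mem_singleton_iff] at h'
    exact h'.symm
  · exact isUpperSet_openCrossing _ _ _ Set.sdiff_subset hX'

/-- **Pivotality in the class.** In the class of `exists_cls_of_neg` (for the pair `n, n'`), let
`η ⊇ ω` be obtained from `ω` by opening at least one of the tuple edges `{a, m}`, `{m, b}` and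
nothing else, with `{m, n'}` closed. Then `η` has an open crossing of `S` from `P` to `Q` and
`η \ {{m, n}}` has none: the interior edge `{m, n}` is pivotal. [folklore] -/
theorem pivotal_of_cls {ω η : BondConfig V} (hη : η ⊆ G.edgeSet) {S P Q : Set V}
    {a m b n n' : V} (ham : G.Adj a m) (hmb : G.Adj m b)
    (hnb : ∀ m', G.Adj m m' → m' = a ∨ m' = b ∨ m' = n ∨ m' = n')
    (hQ : m ∈ Q → a ∈ S → a ∈ Q)
    (hcls : m ∈ S ∧ n ∈ S ∧ s(m, n) ∈ ω ∧ ω ∉ openCrossing S P Q ∧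
      ω ∈ openCrossing (S \ {m}) {n} Q ∧ ω ∈ openCrossing (S \ {m}) P {a} ∧
      ω ∈ openCrossing (S \ {m}) P {b})
    (hωη : ω ⊆ η) (hηω : ∀ e ∈ η, e ∈ ω ∨ e = s(a, m) ∨ e = s(m, b))
    (hopen : s(a, m) ∈ η ∨ s(m, b) ∈ η) (hn' : s(m, n') ∉ η) :
    η ∈ openCrossing S P Q ∧ η \ {s(m, n)} ∉ openCrossing S P Q := by
  obtain ⟨hmS, hnS, hmn, hX, ⟨_, hn, y, hy, hny⟩, ⟨xa, hxa, _, ha, hxaa⟩, ⟨xb, hxb, _, hb, hxbb⟩⟩ :=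
    hcls
  rw [Set.mem_singleton_iff] at hn ha hb
  rw [hn] at hny
  rw [ha] at hxaa
  rw [hb] at hxbb
  have hω : ω ⊆ G.edgeSet := hωη.trans hη
  have sub : S \ {m} ⊆ S := Set.sdiff_subset
  have haS : a ∈ S := sub hxaa.2.1
  have hbS : b ∈ S := sub hxbb.2.1
  have hmQ : m ∉ Q := fun hm => hX ⟨xa, hxa, a, hQ hm haS, openConnIn_mono sub _ _ hxaa⟩
  -- connections of `ω` inside `S \ {m}` are connections of `η` inside `S`
  have lift : ∀ {u v : V}, ω ∈ openConnIn (S \ {m}) u v → η ∈ openConnIn S u v := fun h =>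
    openConnIn_mono sub _ _ (isUpperSet_openConnIn _ _ _ hωη h)
  constructor
  · have hmn' : η ∈ openConnIn S m n := openConnIn_of_adj hmS hnS (hωη hmn) (hω hmn).ne
    have hmy : η ∈ openConnIn S m y := PlanarDuality.openConnIn_trans hmn' (lift hny)
    rcases hopen with h | h
    · exact ⟨xa, hxa, y, hy, PlanarDuality.openConnIn_trans
        (PlanarDuality.openConnIn_trans (lift hxaa) (openConnIn_of_adj haS hmS h ham.ne)) hmy⟩
    · rw [Sym2.eq_swap] at h
      exact ⟨xb, hxb, y, hy, PlanarDuality.openConnIn_trans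
        (PlanarDuality.openConnIn_trans (lift hxbb) (openConnIn_of_adj hbS hmS h hmb.ne.symm)) hmy⟩
  · rintro ⟨x, hx, y', hy', hxy'⟩
    have hη' : η \ {s(m, n)} ⊆ G.edgeSet := Set.sdiff_subset.trans hη
    -- connections of `η \ {m, n}` inside `S \ {m}` are connections of `ω`
    have transfer : ∀ {u v : V}, η \ {s(m, n)} ∈ openConnIn (S \ {m}) u v →
        ω ∈ openConnIn (S \ {m}) u v := fun h =>
      openConnIn_of_forall_edge hη' h fun u' v' he hu' hv' => by
        rcases hηω _ he.1 with h' | h' | h'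
        · exact h'
        · have hm : m ∈ s(u', v') := by rw [h']; exact Sym2.mem_mk_right a m
          rcases Sym2.mem_iff.1 hm with hm' | hm'
          · exact absurd (Set.mem_singleton_iff.2 hm'.symm) hu'.2
          · exact absurd (Set.mem_singleton_iff.2 hm'.symm) hv'.2
        · have hm : m ∈ s(u', v') := by rw [h']; exact Sym2.mem_mk_left m b
          rcases Sym2.mem_iff.1 hm with hm' | hm'
          · exact absurd (Set.mem_singleton_iff.2 hm'.symm) hu'.2
          · exact absurd (Set.mem_singleton_iff.2 hm'.symm) hv'.2
    rcases openConnIn_sdiff_singleton_or hη' m hxy' with h' | ⟨-, hmy'⟩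
    · exact hX ⟨x, hx, y', hy', openConnIn_mono sub _ _ (transfer h')⟩
    · have hne : m ≠ y' := fun h => hmQ (h ▸ hy')
      obtain ⟨m', hadj, hmm', hconn⟩ := exists_adj_mem_openConnIn_sdiff hη' hmy' hne
      have hconn' := transfer hconn
      rcases hnb m' hadj with rfl | rfl | rfl | rfl
      · exact hX ⟨xa, hxa, y', hy', openConnIn_mono sub _ _
          (PlanarDuality.openConnIn_trans hxaa hconn')⟩
      · exact hX ⟨xb, hxb, y', hy', openConnIn_mono sub _ _
          (PlanarDuality.openConnIn_trans hxbb hconn')⟩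
      · exact hmm'.2 rfl
      · exact hn' hmm'.1

end Summit.CriticalPhenomena.CardyFormulaZ2.Cruxes.CriticalPathRSW.FiniteSizeEnvelope.Cone2

namespace Summit.CriticalPhenomena.CardyFormulaZ2.Cruxes.CriticalPathRSW.FiniteSizeEnvelope

open Literature.Probability.LatticeModels Literature.Probability.Percolation

/-- Registered sub-goal `stub_cone2_paths` of stub `stub_cone2` (line `finite-size-envelope`): an
open connection inside `S` on `ℤ²` either avoids a given vertex `m` or splits at `m`
(`Cone2.openConnIn_sdiff_singleton_or`). [folklore] -/
theorem stub_cone2_paths :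
    ∀ (ω : BondConfig (Site 2)), ω ⊆ (zdGraph 2).edgeSet → ∀ (S : Set (Site 2)) (x y m : Site 2),
      ω ∈ openConnIn S x y → ω ∈ openConnIn (S \ {m}) x y ∨ (ω ∈ openConnIn S x m ∧ ω ∈ openConnIn S m y) :=
  fun _ hω _ _ _ m h => Cone2.openConnIn_sdiff_singleton_or hω m h

end Summit.CriticalPhenomena.CardyFormulaZ2.Cruxes.CriticalPathRSW.FiniteSizeEnvelope
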